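import Summits.Ventures.HodgeRepro2.T5SU11XiTransform

/-!
# The Abel constants at integer weights: `Γ(m + 1/2) = (2m)!/(4^m m!) √π`,
`C_{2m+1} = 4^m m! (m−1)!/(2m)!`, `C_{2m} = π (2m−2)!/(4^{m−1} ((m−1)!)²)`, and the `Ξ`-transforms `C_k²`

The half-integer values of `Γ` (`Real.Gamma_nat_add_one_half`, by induction from `Γ(1/2) = √π`) make
the Abel constant `C_k = √π Γ((k−1)/2)/Γ(k/2)` of `T5SU11BetaExp` explicit at every integer weight:
**`C_{2m+1} = 4^m m! (m−1)!/(2m)!`** (`abel_const_odd`: `C_3 = 2`, `C_5 = 4/3`, `C_7 = 16/15`, … — the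
Wallis ratios) and **`C_{2m} = π (2m−2)!/(4^{m−1} ((m−1)!)²)`** (`abel_const_even`: `C_4 = π/2`,
`C_6 = 3π/8`, …). Hence the `Ξ`-transform of the coefficient modulus of `T5SU11XiTransform`,
`∫_G m_k Ξ dν = C_k²`, is rational for odd weights and a rational multiple of `π²` for even weights
(`integral_orbit_rpow_odd_mul_sph_one`, `integral_orbit_rpow_even_mul_sph_one`): `4`, `16/9`, `256/225`, …
and `π²/4`, `9π²/64`, …. Nothing is claimed about (N).

Blind lane: Mathlib + the HodgeRepro2 prefix only; no sorry; axioms ⊆ {propext, Classical.choice,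
Quot.sound}.
-/

namespace Summit.Ventures.HodgeRepro2.T5SU11AbelConstInteger

open MeasureTheory Metric Set Filter Topology
open T5SU11Unimodular T5SU11Fibration T5SU11Cartan T5HaarCircle T5BergmanCoefficient
  T5SU11FibrationHaar T5SU11SphericalFunction T5SU11XiTransform
open scoped Real Nat

/-! ### Half-integer values of `Γ` -/

/-- **`Γ(m + 1/2) = (2m)!/(4^m m!) · √π`** for every natural `m`. -/
theorem Gamma_nat_add_one_half (m : ℕ) :
    Real.Gamma ((m : ℝ) + 1 / 2) = ((2 * m)! : ℝ) / (4 ^ m * (m ! : ℝ)) * √π := by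
  induction m with
  | zero =>
    simp only [Nat.cast_zero, zero_add, Nat.mul_zero, Nat.factorial_zero, pow_zero, Nat.cast_one,
      mul_one, div_one, one_mul]
    exact Real.Gamma_one_half_eq
  | succ n ih =>
    have h1 : ((n + 1 : ℕ) : ℝ) + 1 / 2 = ((n : ℝ) + 1 / 2) + 1 := by push_cast; ring
    have h2 : (n : ℝ) + 1 / 2 ≠ 0 := by positivity
    rw [h1, Real.Gamma_add_one h2, ih]
    have h3 : (2 * (n + 1))! = (2 * n + 2) * ((2 * n + 1) * (2 * n)!) := by
      rw [show 2 * (n + 1) = 2 * n + 1 + 1 by ring, Nat.factorial_succ, Nat.factorial_succ]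
    rw [h3, Nat.factorial_succ]
    push_cast
    have h4 : (0 : ℝ) < 4 ^ n := by positivity
    have h5 : (0 : ℝ) < (n ! : ℝ) := by exact_mod_cast Nat.factorial_pos n
    field_simp
    ring

/-! ### The Abel constants at integer weights -/

/-- **Odd weights**: `C_{2m+1} = 4^m m! (m−1)!/(2m)!` for `m ≥ 1`. -/
theorem abel_const_odd (m : ℕ) (hm : 1 ≤ m) :
    √π * Real.Gamma ((((2 * m + 1 : ℕ) : ℝ) - 1) / 2) / Real.Gamma (((2 * m + 1 : ℕ) : ℝ) / 2)
      = 4 ^ m * (m ! : ℝ) * ((m - 1)! : ℝ) / ((2 * m)! : ℝ) := by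
  obtain ⟨j, rfl⟩ : ∃ j, m = j + 1 := ⟨m - 1, by omega⟩
  have e1 : (((2 * (j + 1) + 1 : ℕ) : ℝ) - 1) / 2 = ((j : ℝ) + 1) := by push_cast; ring
  have e2 : ((2 * (j + 1) + 1 : ℕ) : ℝ) / 2 = ((j + 1 : ℕ) : ℝ) + 1 / 2 := by push_cast; ring
  rw [e1, e2, Gamma_nat_add_one_half, Real.Gamma_nat_eq_factorial, Nat.add_sub_cancel]
  have hs : 0 < √π := Real.sqrt_pos.mpr Real.pi_pos
  have h4 : (0 : ℝ) < 4 ^ (j + 1) := by positivity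
  have h5 : (0 : ℝ) < ((j + 1)! : ℝ) := by exact_mod_cast Nat.factorial_pos _
  have h6 : (0 : ℝ) < ((2 * (j + 1))! : ℝ) := by exact_mod_cast Nat.factorial_pos _
  field_simp

/-- **Even weights**: `C_{2m} = π (2m−2)!/(4^{m−1} ((m−1)!)²)` for `m ≥ 2`. -/
theorem abel_const_even (m : ℕ) (hm : 2 ≤ m) :
    √π * Real.Gamma ((((2 * m : ℕ) : ℝ) - 1) / 2) / Real.Gamma (((2 * m : ℕ) : ℝ) / 2)
      = π * ((2 * m - 2)! : ℝ) / (4 ^ (m - 1) * ((m - 1)! : ℝ) ^ 2) := by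
  obtain ⟨j, rfl⟩ : ∃ j, m = j + 1 := ⟨m - 1, by omega⟩
  have e1 : (((2 * (j + 1) : ℕ) : ℝ) - 1) / 2 = (j : ℝ) + 1 / 2 := by push_cast; ring
  have e2 : ((2 * (j + 1) : ℕ) : ℝ) / 2 = (j : ℝ) + 1 := by push_cast; ring
  rw [e1, e2, Gamma_nat_add_one_half, Real.Gamma_nat_eq_factorial, Nat.add_sub_cancel,
    show 2 * (j + 1) - 2 = 2 * j by omega]
  have hs : 0 < √π := Real.sqrt_pos.mpr Real.pi_pos
  have hsq : √π * √π = π := Real.mul_self_sqrt Real.pi_pos.le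
  have h4 : (0 : ℝ) < 4 ^ j := by positivity
  have h5 : (0 : ℝ) < (j ! : ℝ) := by exact_mod_cast Nat.factorial_pos _
  have h6 : (0 : ℝ) < ((2 * j)! : ℝ) := by exact_mod_cast Nat.factorial_pos _
  field_simp
  linear_combination hsq

section measure

variable [MeasurableSpace Circle] [BorelSpace Circle]

/-! ### The `Ξ`-transforms at integer weights -/

/-- **Odd weights**: `∫_G (1 − |g·0|²)^{(2m+1)/2} Ξ dν = (4^m m! (m−1)!/(2m)!)²` for `m ≥ 1` — a rational
number (`4`, `16/9`, `256/225`, …). -/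
theorem integral_orbit_rpow_odd_mul_sph_one (m : ℕ) (hm : 1 ≤ m) :
    ∫ g, (1 - ‖orbit g‖ ^ 2) ^ (((2 * m + 1 : ℕ) : ℝ) / 2) * sph 1 g ∂(nu haarCircle)
      = (4 ^ m * (m ! : ℝ) * ((m - 1)! : ℝ) / ((2 * m)! : ℝ)) ^ 2 := by
  have hk : (1 : ℝ) < ((2 * m + 1 : ℕ) : ℝ) := by
    have : (1 : ℝ) ≤ m := by exact_mod_cast hm
    push_cast; linarith
  rw [integral_orbit_rpow_mul_sph_one_eq_sq hk, abel_const_odd m hm]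

/-- **Even weights**: `∫_G (1 − |g·0|²)^{m} Ξ dν = (π (2m−2)!/(4^{m−1} ((m−1)!)²))²` for `m ≥ 2` — a
rational multiple of `π²` (`π²/4`, `9π²/64`, …). -/
theorem integral_orbit_rpow_even_mul_sph_one (m : ℕ) (hm : 2 ≤ m) :
    ∫ g, (1 - ‖orbit g‖ ^ 2) ^ (((2 * m : ℕ) : ℝ) / 2) * sph 1 g ∂(nu haarCircle)
      = (π * ((2 * m - 2)! : ℝ) / (4 ^ (m - 1) * ((m - 1)! : ℝ) ^ 2)) ^ 2 := by
  have hk : (1 : ℝ) < ((2 * m : ℕ) : ℝ) := by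
    have : (2 : ℝ) ≤ m := by exact_mod_cast hm
    push_cast; linarith
  rw [integral_orbit_rpow_mul_sph_one_eq_sq hk, abel_const_even m hm]

/-- `∫_G (1 − |g·0|²)^{5/2} Ξ dν = 16/9`. -/
theorem integral_orbit_rpow_five_mul_sph_one :
    ∫ g, (1 - ‖orbit g‖ ^ 2) ^ ((5 : ℝ) / 2) * sph 1 g ∂(nu haarCircle) = 16 / 9 := by
  rw [show ((5 : ℝ) / 2) = ((2 * 2 + 1 : ℕ) : ℝ) / 2 by norm_num,
    integral_orbit_rpow_odd_mul_sph_one 2 (by norm_num)]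
  norm_num [Nat.factorial]

/-- `∫_G (1 − |g·0|²)^{3} Ξ dν = 9π²/64`. -/
theorem integral_orbit_rpow_six_mul_sph_one :
    ∫ g, (1 - ‖orbit g‖ ^ 2) ^ ((6 : ℝ) / 2) * sph 1 g ∂(nu haarCircle) = 9 * π ^ 2 / 64 := by
  rw [show ((6 : ℝ) / 2) = ((2 * 3 : ℕ) : ℝ) / 2 by norm_num,
    integral_orbit_rpow_even_mul_sph_one 3 (by norm_num)]
  norm_num [Nat.factorial]
  ring

end measure

end Summit.Ventures.HodgeRepro2.T5SU11AbelConstInteger
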